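import Summits.CriticalPhenomena.PercolationContinuityZ3.Theorems.PercNearOneGluingNoHeavyLowerTailAntitheticCycleRuns
import Summits.CriticalPhenomena.PercolationContinuityZ3.Theorems.PercNearOneGluingNoHeavyLowerTailAntitheticLatticePieces
import Summits.CriticalPhenomena.PercolationContinuityZ3.Theorems.PercNearOneGluingNoHeavyLowerTailAntitheticPeelTools
import HarnessLib

/-!
# `NoHeavyLowerTail` (stmt-CriticalPhenomena-4575) — antithetic cluster pairs: the STAIRCASE PIECE on a cycle (THEOREM C, file C2a; prim-hp-2 gen 39,
# HOME/THEOREM-C-cycles.md "LEAN BLUEPRINT")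

Support file (`--supports stmt-CriticalPhenomena-4575`, hull-port prover `prim-hp-2`, gen 39).  No named facts, no sorries; standard axioms.  The `def`
`Antithetic.Cyc.lab` is proof-internal bookkeeping.

SETTING (…AntitheticCycleRuns): a cycle `v 0 = s, …, v (n−1)`, pairs `edge i = v i v (i+1)`; a position `a` (`2 ≤ a < n`; the vertex `v a` sits between
`edge (a−1)` and `edge a`), legs `u = (edge 0, …, edge (a−1))` and `w = (edge (n−1), …, edge a)` read from `s`.  A STAIRCASE PIECE with cube leg `u`,
run parameter `1 ≤ k < a` and partner tie length `1 ≤ m`: blocks `β₀ = {edge 0..edge k}`, `π = {edge i : max(a, n−m) ≤ i ≤ n−1}`, the TIE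
`{edge (a−1), edge a}` (merged with `β₀` when `k+1 = a`, with `π` when `n − m ≤ a`), all other pairs free; encoded by the label function `Cyc.lab`
(`lab i = lab j` iff `edge i, edge j` lie in a common block) and the algebra `𝒜 = {A : A respects the labels}`.  A TOP colouring `N` has `edge 0..edge (k−1)`
red, `edge k` blue, the partner `edge a..edge (n−1)` red and `edge (a−1)` blue.
* `Cyc.Stair.pre_flip`, `suf_flip_le` — for `A ⊆ B` in `𝒜`: `pre (N ∆ A) ∈ {0, k}` according to `edge 0 ∈ A`, and `suf (N ∆ B) ≤ suf (N ∆ A) ≤ n − a`;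
* `Cyc.Stair.anti` — hence the red edge cluster is antitone along the piece (validity);
* `Cyc.Stair.sum_nonneg` — `0 ≤ Σ_{M ∈ piece} Δ_E(M)` (`LatticePieces.piece_algebra_sum_nonneg`);
* `Cyc.Stair.member` — members keep the colour change at `a`, keep `edge (k−1) ≠ edge k` (so they are never one-change at `a`), and are constant on `β₀ ∖`
  and on `π` — the facts from which the partition of the family "change at a" is assembled (file C2b).
[cite: VandenbergHaggstromKahn2005, §1 p. 6 ("Harris' inequality")]
-/

noncomputable section

namespace Summit.CriticalPhenomena.PercolationContinuityZ3.Theorems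

open Literature.Probability.Percolation
open scoped Classical symmDiff

namespace Antithetic

namespace Cyc

variable {V : Type*}

/-- Block labels of the staircase piece (module docstring): `0` = tie class (with merges), `1` = `β₀`, `2` = `π`, `i + 3` = singleton. [this work] -/
def lab (n a k m i : ℕ) : ℕ :=
  if i = a - 1 ∨ i = a ∨ (k + 1 = a ∧ i ≤ k) ∨ (n - m ≤ a ∧ a ≤ i) then 0
  else if i ≤ k then 1 else if n - m ≤ i then 2 else i + 3

namespace Stair

variable {n : ℕ} {v : ℕ → V} (hn : 3 ≤ n) (hinj : ∀ i j, i < n → j < n → v i = v j → i = j) (hper : v n = v 0)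
variable {a k m : ℕ} (hk1 : 1 ≤ k) (hka : k < a) (han : a < n) (hm1 : 1 ≤ m)

include hk1 hka in
/-- The run block: indices `i ≤ k` share the block of `0`. -/
theorem lab_eq_of_le_k {i : ℕ} (hi : i ≤ k) : lab n a k m i = lab n a k m 0 := by
  unfold lab
  by_cases hmerge : k + 1 = a
  · rw [if_pos (Or.inr (Or.inr (Or.inl ⟨hmerge, hi⟩))), if_pos (Or.inr (Or.inr (Or.inl ⟨hmerge, Nat.zero_le _⟩)))]
  · have h1 : ¬ (i = a - 1 ∨ i = a ∨ (k + 1 = a ∧ i ≤ k) ∨ (n - m ≤ a ∧ a ≤ i)) := by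
      intro h; rcases h with h | h | h | h <;> omega
    have h2 : ¬ (0 = a - 1 ∨ 0 = a ∨ (k + 1 = a ∧ 0 ≤ k) ∨ (n - m ≤ a ∧ a ≤ 0)) := by
      intro h; rcases h with h | h | h | h <;> omega
    rw [if_neg h1, if_neg h2, if_pos hi, if_pos (Nat.zero_le _)]

/-- The tie: `edge (a−1)` and `edge a` share a block. -/
theorem lab_tie : lab n a k m (a - 1) = lab n a k m a := by
  unfold lab; rw [if_pos (Or.inl rfl), if_pos (Or.inr (Or.inl rfl))]

include hka han in
/-- The partner block: indices `i ≥ max (a, n − m)` share the block of `n − 1`. -/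
theorem lab_eq_of_partner {i : ℕ} (hi : a ≤ i) (him : n - m ≤ i) (hin : i < n) : lab n a k m i = lab n a k m (n - 1) := by
  unfold lab
  by_cases hmerge : n - m ≤ a
  · rw [if_pos (Or.inr (Or.inr (Or.inr ⟨hmerge, hi⟩))), if_pos (Or.inr (Or.inr (Or.inr ⟨hmerge, by omega⟩)))]
  · have h1 : ¬ (i = a - 1 ∨ i = a ∨ (k + 1 = a ∧ i ≤ k) ∨ (n - m ≤ a ∧ a ≤ i)) := by
      intro h; rcases h with h | h | h | h <;> omega
    have h2 : ¬ (n - 1 = a - 1 ∨ n - 1 = a ∨ (k + 1 = a ∧ n - 1 ≤ k) ∨ (n - m ≤ a ∧ a ≤ n - 1)) := by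
      intro h; rcases h with h | h | h | h <;> omega
    have h3 : ¬ i ≤ k := by omega
    have h4 : ¬ n - 1 ≤ k := by omega
    have h5 : n - m ≤ n - 1 := by omega
    rw [if_neg h1, if_neg h2, if_neg h3, if_neg h4, if_pos him, if_pos h5]

variable (N : Set (Sym2 V)) (hN0 : ∀ i, i < k → edge v i ∈ N) (hNk : edge v k ∉ N) (hNw : ∀ i, a ≤ i → i < n → edge v i ∈ N)
  (hNa : edge v (a - 1) ∉ N)

/-- Membership in a flipped colouring. -/
theorem mem_flip {A : Set (Sym2 V)} {e : Sym2 V} : e ∈ N ∆ A ↔ ((e ∈ N) ↔ (e ∉ A)) := by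
  rw [Set.mem_symmDiff]; tauto

include hk1 hka han hN0 hNk in
/-- **Prefix run along the piece**: `pre (N ∆ A) = 0` if `edge 0 ∈ A`, `= k` otherwise (for `A` respecting the blocks). [this work] -/
theorem pre_flip {A : Set (Sym2 V)} (hA : ∀ i j, i < n → j < n → lab n a k m i = lab n a k m j → (edge v i ∈ A ↔ edge v j ∈ A)) :
    (edge v 0 ∈ A → pre n v (N ∆ A) = 0) ∧ (edge v 0 ∉ A → pre n v (N ∆ A) = k) := by
  constructor
  · intro h0
    by_contra hne
    have hpos : 0 < pre n v (N ∆ A) := Nat.pos_of_ne_zero hne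
    have := red_of_lt_pre (N ∆ A) hpos
    rw [mem_flip] at this
    exact (this.1 (hN0 0 (by omega))) h0
  · intro h0
    have hblk : ∀ i, i ≤ k → edge v i ∉ A := fun i hi hiA =>
      h0 ((hA i 0 (by omega) (by omega) (lab_eq_of_le_k hk1 hka hi)).1 hiA)
    refine le_antisymm ?_ (le_pre (N ∆ A) (by omega) fun i hi => (mem_flip N).2 (iff_of_true (hN0 i hi) (hblk i hi.le)))
    by_contra hlt
    push Not at hlt
    have := red_of_lt_pre (N ∆ A) hlt
    rw [mem_flip] at this
    exact hNk (this.2 (hblk k le_rfl))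

include hka han hNw hNa in
/-- **Suffix run along the piece**: it never passes the tie, and it is antitone in the flip set. [this work] -/
theorem suf_flip_le {A B : Set (Sym2 V)}
    (hB : ∀ i j, i < n → j < n → lab n a k m i = lab n a k m j → (edge v i ∈ B ↔ edge v j ∈ B)) (hAB : A ⊆ B) :
    suf n v (N ∆ B) ≤ n - a ∧ suf n v (N ∆ B) ≤ suf n v (N ∆ A) := by
  have hle : suf n v (N ∆ B) ≤ n - a := by
    by_contra hlt
    push Not at hlt
    -- edges a and a-1 are both red in N ∆ B: impossible across the tie
    have ha' : edge v a ∈ N ∆ B := by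
      have := red_of_lt_suf (n := n) (v := v) (N ∆ B) (j := n - 1 - a) (by omega)
      rwa [show n - 1 - (n - 1 - a) = a by omega] at this
    have ha1 : edge v (a - 1) ∈ N ∆ B := by
      have := red_of_lt_suf (n := n) (v := v) (N ∆ B) (j := n - a) (by omega)
      rwa [show n - 1 - (n - a) = a - 1 by omega] at this
    rw [mem_flip] at ha' ha1
    have haB : edge v a ∉ B := ha'.1 (hNw a le_rfl han)
    have ha1B : edge v (a - 1) ∉ B := fun h => haB ((hB (a - 1) a (by omega) han lab_tie).1 h)
    exact hNa (ha1.2 ha1B)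
  refine ⟨hle, le_suf (N ∆ A) ((hle.trans (Nat.sub_le n a)).trans le_rfl) fun j hj => ?_⟩
  have hred := red_of_lt_suf (N ∆ B) hj
  rw [mem_flip] at hred ⊢
  have hi : a ≤ n - 1 - j := by omega
  have hN : edge v (n - 1 - j) ∈ N := hNw _ hi (by omega)
  exact iff_of_true hN fun h => (hred.1 hN) (hAB h)

include hn hinj hper hk1 hka han hN0 hNk hNw hNa in
/-- **Validity of the staircase piece**: the red edge cluster of `s` is antitone along the piece. [this work] -/
theorem anti {A B : Set (Sym2 V)} (hA : ∀ i j, i < n → j < n → lab n a k m i = lab n a k m j → (edge v i ∈ A ↔ edge v j ∈ A))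
    (hB : ∀ i j, i < n → j < n → lab n a k m i = lab n a k m j → (edge v i ∈ B ↔ edge v j ∈ B)) (hAB : A ⊆ B) :
    openEdgeCluster ((N ∆ B) ∩ edgeSet n v) (v 0) ⊆ openEdgeCluster ((N ∆ A) ∩ edgeSet n v) (v 0) := by
  rw [openEdgeCluster_eq (N ∆ B) hn hinj hper, openEdgeCluster_eq (N ∆ A) hn hinj hper]
  rintro e ⟨i, hi, rfl, hrun⟩
  refine ⟨i, hi, rfl, ?_⟩
  obtain ⟨hsle, hsmono⟩ := suf_flip_le hka han N hNw hNa hB hAB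
  rcases hrun with h | h
  · left
    obtain ⟨hB0, hB1⟩ := pre_flip hk1 hka han N hN0 hNk hB
    obtain ⟨hA0, hA1⟩ := pre_flip hk1 hka han N hN0 hNk hA
    by_cases h0 : edge v 0 ∈ A
    · rw [hB0 (hAB h0)] at h; omega
    · rw [hA1 h0]
      by_cases h0B : edge v 0 ∈ B
      · rw [hB0 h0B] at h; omega
      · rw [hB1 h0B] at h; exact h
  · right; omega

include hn hinj hper hk1 hka han hN0 hNk hNw hNa in
/-- **The staircase piece has nonnegative antithetic sum** (all increasing `F, G`). [this work] -/
theorem sum_nonneg [Fintype V] {F G : Set (Sym2 V) → ℝ} (hF : Monotone F) (hG : Monotone G) :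
    0 ≤ ∑ M ∈ (Finset.univ.filter fun A : Set (Sym2 V) =>
        ∀ i j, i < n → j < n → lab n a k m i = lab n a k m j → (edge v i ∈ A ↔ edge v j ∈ A)).image (N ∆ ·),
      Peel.delta F G (edgeSet n v) (v 0) M := by
  have h := piece_algebra_sum_nonneg (edgeSet n v) (v 0) N
    (Finset.univ.filter fun A : Set (Sym2 V) => ∀ i j, i < n → j < n → lab n a k m i = lab n a k m j → (edge v i ∈ A ↔ edge v j ∈ A))
    ?_ ?_ ?_ ?_ ?_ hF hG
  · simpa only [Peel.delta] using h
  · intro A hA B hB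
    rw [Finset.mem_filter] at hA hB ⊢
    exact ⟨Finset.mem_univ _, fun i j hi hj hl => by rw [Set.mem_inter_iff, Set.mem_inter_iff, hA.2 i j hi hj hl, hB.2 i j hi hj hl]⟩
  · intro A hA B hB
    rw [Finset.mem_filter] at hA hB ⊢
    exact ⟨Finset.mem_univ _, fun i j hi hj hl => by rw [Set.mem_union, Set.mem_union, hA.2 i j hi hj hl, hB.2 i j hi hj hl]⟩
  · intro A hA
    rw [Finset.mem_filter] at hA ⊢
    exact ⟨Finset.mem_univ _, fun i j hi hj hl => by rw [Set.mem_compl_iff, Set.mem_compl_iff, hA.2 i j hi hj hl]⟩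
  · rw [Finset.mem_filter]
    exact ⟨Finset.mem_univ _, fun i j _ _ _ => by simp⟩
  · intro A hA B hB hAB
    rw [Finset.mem_filter] at hA hB
    exact anti hn hinj hper hk1 hka han N hN0 hNk hNw hNa hA.2 hB.2 hAB

include hk1 hka han hN0 hNk hNw hNa in
/-- **Members of the staircase piece**: the colour changes at `a` (tie) and inside `β₀` (between `edge (k−1)` and `edge k`) persist, `β₀`'s run part and
the partner block are monochromatic. [this work] -/
theorem member {A : Set (Sym2 V)} (hA : ∀ i j, i < n → j < n → lab n a k m i = lab n a k m j → (edge v i ∈ A ↔ edge v j ∈ A)) :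
    (edge v (a - 1) ∈ N ∆ A ↔ edge v a ∉ N ∆ A) ∧ (edge v (k - 1) ∈ N ∆ A ↔ edge v k ∉ N ∆ A) ∧
      (∀ i, i < k → (edge v i ∈ N ∆ A ↔ edge v 0 ∈ N ∆ A)) ∧
      (∀ i, a ≤ i → n - m ≤ i → i < n → (edge v i ∈ N ∆ A ↔ edge v (n - 1) ∈ N ∆ A)) := by
  refine ⟨?_, ?_, fun i hi => ?_, fun i hia him hin => ?_⟩
  · have ht := hA (a - 1) a (by omega) han lab_tie
    rw [mem_flip, mem_flip, ht]
    have h1 := hNw a le_rfl han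
    tauto
  · have ht := hA (k - 1) k (by omega) (by omega) (by rw [lab_eq_of_le_k hk1 hka (by omega : k - 1 ≤ k), lab_eq_of_le_k hk1 hka le_rfl])
    rw [mem_flip, mem_flip, ht]
    have h1 := hN0 (k - 1) (by omega)
    tauto
  · have ht := hA i 0 (by omega) (by omega) (lab_eq_of_le_k hk1 hka hi.le)
    rw [mem_flip, mem_flip, ht]
    have h1 := hN0 i hi; have h2 := hN0 0 (by omega)
    tauto
  · have ht := hA i (n - 1) hin (by omega) (lab_eq_of_partner hka han hia him hin)
    rw [mem_flip, mem_flip, ht]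
    have h1 := hNw i hia hin; have h2 := hNw (n - 1) (by omega) (by omega)
    tauto

end Stair

end Cyc

end Antithetic

end Summit.CriticalPhenomena.PercolationContinuityZ3.Theorems
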